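import Summits.BirchSwinnertonDyer.BirchSwinnertonDyer.Theorems.Rank2ObservatoryIsoTable
import Literature.NumberTheory.EllipticCurves.XCubeAddDXSharpRankSha
import Literature.NumberTheory.EllipticCurves.ShaPrimaryIsogenyKill
import HarnessLib

/-!
# BirchSwinnertonDyer / ShaPrimaryTransfer — crux `FiniteShaComponentTransfer` (stmt-BirchSwinnertonDyer-22356):
# THE KERNEL-ISO TABLE IS A TABLE OF DOORS AT 2 — a checked `IsoRow` gives `Ш(E/ℚ)[2] = 0`, `Ш(E/ℚ)[2^∞] = 0`,
# `t_2(E) = 0` and `corank_{ℤ₂} Sel_{2^∞}(E/ℚ) = rank E(ℚ) = 2`, not only `rank E(ℚ) = 2`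

Route `ShaPrimaryTransfer` (D-0145 LINE 2): T = `FiniteShaComponentTransfer` (stmt-22356; conjecture-grade at corank `≥ 2`,
UNCHANGED), O = `OneFiniteShaComponent`. Helper file (prover seat `bsd-line-spt-p1` g34, `--supports stmt-22356`).
BSD is NOT proved by any of this; T is not proved by any of this.

The rank-`2` observatory's KERNEL-ISO instrument (`Rank2ObservatoryIsoTable`, data chunks `Rank2ObservatoryIsoRowsNNN`,
`NNN = 000 … 410`) certifies, for a census curve `E` with one rational point of order `2`, a DATA record `R : IsoRow`
whose Boolean `R.check` (kernel `decide`) implies `rank_ℤ E(ℚ) = 2` (`IsoRow.mordellWeilRank_eq_two`). The check contains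
MORE than the rank: its two `sideCheck`s give Selmer supersets `S^{(φ̂)}(E'/ℚ) = S(a,b) ⊆ D₁`, `S^{(φ)}(E/ℚ) = S'(a,b) ⊆ D₂`
with `log₂ #D₁ + log₂ #D₂ ≤ 4 = rank + 2` (Silverman–Tate's `2^{r+2} = #α·#ᾱ ≤ #S·#S'`), i.e. the descent via `2`-isogeny
is SHARP. By the tree's sharpness theorem (`XCubeAddDXSharpRankSha` §1: `dim₂ S + dim₂ S' ≤ rank + 2 ⇒ Ш(E)[φ] = Ш(E')[φ̂] = 0
⇒ Ш(E/ℚ)[2] = 0`, Silverman X.4.7 with X.4.2(a)) every checked row is therefore a DOOR AT 2 of route ShaPrimaryTransfer: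

* `IsoRow.forall_mem_sha_two_smul_eq_zero_ab_of_check` — on the descent model `E_{a,b}`: `Ш[2] = 0`;
* **`IsoRow.door_of_check`** — on the CENSUS MODEL `R.curve`: `rank = 2 ∧ Ш(E/ℚ)[2] = ⊥ ∧ Ш(E/ℚ)[2^∞] = ⊥ ∧ t_2(E) = 0 ∧
  corank_{ℤ₂} Sel_{2^∞}(E/ℚ) = 2` (transport along the row's change of variables; Greenberg's identity
  `corank Sel = rank + t_p`, tree theorem `selmerCorank_eq_mordellWeilRank_add_holds`);
* `IsoRow.door_of_all` / `IsoRow.doors_of_all` — the chunk form: from a data chunk's kernel theorem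
  `isoRowsNNN.all IsoRow.check = true`, EVERY row of the chunk is a door at `2` (O holds at `p₀ = 2`, T's hypothesis
  `t_2(E) = 0` is armed, unconditionally; T then predicts `t_q(E) = 0` at every prime `q`).

So the whole KERNEL-ISO table (411 chunks of the rank-2 census, conductor `< 5·10⁵`) converts into unconditional
`t_2 = 0 ∧ Ш[2^∞] = 0 ∧ rank = 2` certificates by one-line corollaries (companion files `…IsoRowDoorsNN`), exactly as
the SEL2CUBIC census rows were converted for curves without rational `2`-torsion (g28–g32). No new descent is run here.

References: J. H. Silverman, *AEC* 2nd ed., Thm. X.4.2(a), Prop. X.4.7, X.4.9; J. H. Silverman, J. Tate, *Rational Points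
on Elliptic Curves* §3.6; R. Greenberg, LNM 1716 (1999), §1.
-/

-- D-0017: single-problem summit, so `Summit.BirchSwinnertonDyer.BirchSwinnertonDyer.…` repeats a namespace BY DESIGN.
set_option linter.dupNamespace false

noncomputable section

namespace Summit.BirchSwinnertonDyer.BirchSwinnertonDyer.Rank2Observatory.IsoLocal.IsoRow

open scoped Classical
open Literature.NumberTheory.EllipticCurves WeierstrassCurve
open Summit.BirchSwinnertonDyer.BirchSwinnertonDyer.Rank2Observatory.IsoLocal

/-! ## §1 The descent model `E_{a,b}` of a checked row: sharp descent, `Ш[2] = 0` -/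

/-- The pieces of `R.check` used below: the transport hypotheses, `b(a² − 4b) ≠ 0`, the two Selmer supersets and
the sharp count `log₂ #D₁ + log₂ #D₂ ≤ 4`. [cite: SilvermanTate2015, §3.6] -/
theorem check_parts (R : IsoRow) (h : R.check = true) :
    (R.scaled = true ∨ (R.a₁ = 0 ∧ R.a₃ = 0)) ∧
      R.e ^ 3 + R.A.1 * R.e ^ 2 + R.A.2.1 * R.e + R.A.2.2 = 0 ∧
      R.ab.2 * (R.ab.1 ^ 2 - 4 * R.ab.2) ≠ 0 ∧
      twoIsogenySelmerGroup R.ab.1 R.ab.2 ⊆ R.s₁.D.toFinset ∧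
      twoIsogenySelmerGroup (-2 * R.ab.1) (R.ab.1 ^ 2 - 4 * R.ab.2) ⊆ R.s₂.D.toFinset ∧
      Nat.log 2 R.s₁.D.toFinset.card + Nat.log 2 R.s₂.D.toFinset.card ≤ 4 := by
  simp only [check, Bool.and_eq_true, Bool.or_eq_true, beq_iff_eq, bne_iff_ne, ne_eq,
    decide_eq_true_eq] at h
  obtain ⟨⟨⟨⟨⟨⟨hsc, he⟩, hab⟩, h₁⟩, h₂⟩, hcard⟩, -⟩ := h
  obtain ⟨hD₁, -⟩ := sideCheck_sound hab h₁
  obtain ⟨hD₂, -⟩ := sideCheck_sound (twoIsogenyCodomain_ne_zero hab) h₂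
  refine ⟨hsc, he, hab, hD₁, hD₂, ?_⟩
  rw [List.card_toFinset, List.card_toFinset]
  omega

/-- **The descent of a checked row is SHARP**: `dim₂ S(a,b) + dim₂ S'(a,b) ≤ rank E_{a,b}(ℚ) + 2` (both sides equal `4`).
[cite: SilvermanAEC2009, Prop. X.4.7 and Thm. X.4.2(a)] [cite: SilvermanTate2015, §3.6] -/
theorem twoIsogenySelmerRank_add_le_of_check (R : IsoRow) (h : R.check = true) :
    twoIsogenySelmerRank R.ab.1 R.ab.2 + twoIsogenySelmerRank' R.ab.1 R.ab.2 ≤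
      (⟨0, (R.ab.1 : ℚ), 0, (R.ab.2 : ℚ), 0⟩ : WeierstrassCurve ℚ).mordellWeilRank + 2 := by
  obtain ⟨hsc, he, hab, hD₁, hD₂, hcard⟩ := check_parts R h
  -- the rank of the descent model is `2` (the row theorem, transported back)
  have hr : (⟨0, (R.ab.1 : ℚ), 0, (R.ab.2 : ℚ), 0⟩ : WeierstrassCurve ℚ).mordellWeilRank = 2 := by
    obtain ⟨C, hC⟩ := exists_transport R hsc he
    have ht := mordellWeilRank_variableChange_holds R.curve C
    rw [mordellWeilRank_variableChange, hC] at ht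
    rw [ht]
    exact mordellWeilRank_eq_two R h
  have e1 : twoIsogenySelmerRank R.ab.1 R.ab.2 ≤ Nat.log 2 R.s₁.D.toFinset.card :=
    Nat.log_mono_right (Finset.card_le_card hD₁)
  have e2 : twoIsogenySelmerRank' R.ab.1 R.ab.2 ≤ Nat.log 2 R.s₂.D.toFinset.card := by
    unfold twoIsogenySelmerRank' twoIsogenySelmerRank
    exact Nat.log_mono_right (Finset.card_le_card hD₂)
  omega

/-- **`Ш(E_{a,b}/ℚ)[2] = 0` for the descent model of a checked row** (sharp descent via `2`-isogeny kills both
`φ`-parts of `Ш`, and `φ̂ ∘ φ = [2]`). [cite: SilvermanAEC2009, Prop. X.4.7, Thm. X.4.2(a) and Thm. III.6.2(a)] -/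
theorem forall_mem_sha_two_smul_eq_zero_ab_of_check (R : IsoRow) (h : R.check = true) :
    ∀ c ∈ (⟨0, (R.ab.1 : ℚ), 0, (R.ab.2 : ℚ), 0⟩ : WeierstrassCurve ℚ).sha, 2 • c = 0 → c = 0 := by
  obtain ⟨-, -, hab, -⟩ := check_parts R h
  haveI := isElliptic_halfModel hab
  haveI := isElliptic_mk_of_ne_zero (F := ℚ) hab
  exact forall_mem_sha_two_smul_eq_zero_of_selmerRank_add_le hab (twoIsogenySelmerRank_add_le_of_check R h)

/-! ## §2 The census model: the door at 2 -/

/-- The census model of a checked row is an elliptic curve (it is a change of variables away from `E_{a,b}`,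
`b(a² − 4b) ≠ 0`). [cite: SilvermanAEC2009, III.3.1(b)] -/
theorem isElliptic_curve_of_check (R : IsoRow) (h : R.check = true) : R.curve.IsElliptic := by
  obtain ⟨hsc, he, hab, -⟩ := check_parts R h
  obtain ⟨C, hC⟩ := exists_transport R hsc he
  haveI := isElliptic_mk_of_ne_zero (F := ℚ) hab
  have hR : R.curve = C⁻¹ • (⟨0, (R.ab.1 : ℚ), 0, (R.ab.2 : ℚ), 0⟩ : WeierstrassCurve ℚ) := by
    rw [← hC, inv_smul_smul]
  rw [hR]
  infer_instance

/-- From `Ш[p] = ⊥` (as a subgroup) back to the descent currency «every class of `Ш` killed by `p` is zero».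
[cite: SilvermanAEC2009, Thm X.4.2(a)] -/
theorem forall_of_sha_torsionBy_eq_bot {K : Type} [Field K] [NumberField K] (W : WeierstrassCurve K) (p : ℕ)
    (h : AddSubgroup.torsionBy W.sha (p : ℤ) = ⊥) : ∀ c ∈ W.sha, p • c = 0 → c = 0 := by
  intro c hc hpc
  have hmem : (⟨c, hc⟩ : W.sha) ∈ AddSubgroup.torsionBy W.sha (p : ℤ) :=
    AddSubgroup.torsionBy.nsmul_iff.mpr (Subtype.ext (by simpa using hpc))
  rw [h, AddSubgroup.mem_bot] at hmem
  exact congrArg Subtype.val hmem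

/-- **THE KERNEL-ISO DOOR AT 2.** For every `IsoRow` passing `IsoRow.check` (kernel `decide` in the data chunks), the census
model `E = R.curve` has `rank_ℤ E(ℚ) = 2`, `Ш(E/ℚ)[2] = 0`, `Ш(E/ℚ)[2^∞] = 0`, `t_2(E) = corank_{ℤ₂} Ш(E/ℚ)[2^∞] = 0` and
`corank_{ℤ₂} Sel_{2^∞}(E/ℚ) = 2` — UNCONDITIONALLY (no `L`-function, no named fact).
[cite: SilvermanAEC2009, Prop. X.4.7 and Thm. X.4.2(a)] [cite: Greenberg1999LNM, §1 (pp. 54–57)] -/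
theorem door_of_check (R : IsoRow) (h : R.check = true) :
    haveI := isElliptic_curve_of_check R h
    R.curve.mordellWeilRank = 2 ∧ (∀ c ∈ R.curve.sha, 2 • c = 0 → c = 0) ∧
      AddCommGroup.primaryComponent R.curve.sha 2 = ⊥ ∧ R.curve.shaCorank 2 = 0 ∧ R.curve.selmerCorank 2 = 2 := by
  haveI := isElliptic_curve_of_check R h
  haveI : Fact (Nat.Prime 2) := ⟨Nat.prime_two⟩
  obtain ⟨hsc, he, hab, -⟩ := check_parts R h
  obtain ⟨C, hC⟩ := exists_transport R hsc he
  have hr := mordellWeilRank_eq_two R h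
  -- `Ш[2] = 0` on `E_{a,b}`, transported to the census model along `C • R.curve = E_{a,b}`
  have hbot : AddSubgroup.torsionBy R.curve.sha ((2 : ℕ) : ℤ) = ⊥ :=
    sha_torsionBy_eq_bot_of_smul_eq hC 2
      (sha_torsionBy_eq_bot_of_forall _ 2 (forall_mem_sha_two_smul_eq_zero_ab_of_check R h))
  have hsha : ∀ c ∈ R.curve.sha, 2 • c = 0 → c = 0 := forall_of_sha_torsionBy_eq_bot R.curve 2 hbot
  have ht : R.curve.shaCorank 2 = 0 := shaCorank_eq_zero_of_forall _ 2 hsha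
  refine ⟨hr, hsha, primaryComponent_sha_eq_bot_of_forall _ hsha, ht, ?_⟩
  rw [R.curve.selmerCorank_eq_mordellWeilRank_add_holds 2, hr, ht]

/-- The door, `t_2` only: `R.check = true ⇒ t_2(R.curve) = 0`. [cite: Greenberg1999LNM, §1 (pp. 54–57)] -/
theorem shaCorank_two_eq_zero_of_check (R : IsoRow) (h : R.check = true) :
    haveI := isElliptic_curve_of_check R h
    R.curve.shaCorank 2 = 0 :=
  (door_of_check R h).2.2.2.1

/-- O at `p₀ = 2` for the row's curve, in the route's `∃ p₀` shape. [cite: Greenberg1999LNM, §1 (pp. 54–57)] -/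
theorem exists_shaCorank_eq_zero_of_check (R : IsoRow) (h : R.check = true) :
    haveI := isElliptic_curve_of_check R h
    ∃ (p : ℕ) (_ : Fact p.Prime), R.curve.shaCorank p = 0 :=
  ⟨2, ⟨Nat.prime_two⟩, shaCorank_two_eq_zero_of_check R h⟩

/-! ## §3 Chunk forms (the shape of the data chunks' kernel theorems) -/

/-- Chunk form over `List.all`: every row of a checked list is a door at `2`.
[cite: SilvermanAEC2009, Prop. X.4.7 and Thm. X.4.2(a)] -/
theorem door_of_all {rows : List IsoRow} (h : rows.all IsoRow.check = true) {R : IsoRow} (hR : R ∈ rows) :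
    haveI := isElliptic_curve_of_check R (List.all_eq_true.mp h R hR)
    R.curve.mordellWeilRank = 2 ∧ (∀ c ∈ R.curve.sha, 2 • c = 0 → c = 0) ∧
      AddCommGroup.primaryComponent R.curve.sha 2 = ⊥ ∧ R.curve.shaCorank 2 = 0 ∧ R.curve.selmerCorank 2 = 2 :=
  door_of_check R (List.all_eq_true.mp h R hR)

/-- Chunk form, `t_2` only, with the elliptic instance supplied by the caller (any instance: `IsElliptic` is a `Prop`).
[cite: Greenberg1999LNM, §1 (pp. 54–57)] -/
theorem shaCorank_two_eq_zero_of_all {rows : List IsoRow} (h : rows.all IsoRow.check = true) {R : IsoRow}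
    (hR : R ∈ rows) [R.curve.IsElliptic] : R.curve.shaCorank 2 = 0 := by
  have := shaCorank_two_eq_zero_of_check R (List.all_eq_true.mp h R hR)
  exact this

/-- Chunk form, full door, with the elliptic instance supplied by the caller.
[cite: SilvermanAEC2009, Prop. X.4.7 and Thm. X.4.2(a)] [cite: Greenberg1999LNM, §1 (pp. 54–57)] -/
theorem doors_of_all {rows : List IsoRow} (h : rows.all IsoRow.check = true) {R : IsoRow}
    (hR : R ∈ rows) [R.curve.IsElliptic] :
    R.curve.mordellWeilRank = 2 ∧ (∀ c ∈ R.curve.sha, 2 • c = 0 → c = 0) ∧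
      AddCommGroup.primaryComponent R.curve.sha 2 = ⊥ ∧ R.curve.shaCorank 2 = 0 ∧ R.curve.selmerCorank 2 = 2 := by
  have := door_of_check R (List.all_eq_true.mp h R hR)
  exact this

end Summit.BirchSwinnertonDyer.BirchSwinnertonDyer.Rank2Observatory.IsoLocal.IsoRow

end
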